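import Summits.Ventures.PercRepro.S1TriangleVCount
import Summits.Ventures.PercRepro.S1CellQ

/-!
# PercRepro — the cell `(8, 27)` of the `q = 4` window, by LEMMA V (p2, gen 18)

LEMMA V (`S1TriangleVCount`) bounds the triangles of the `e`-free core by the size of the ground set:
`s₃ ≤ ⌊n²/9⌋`, i.e. `136` at `n = 35` — where LEMMA R gives `198` and the nullity table `cq2 27 = 201`. With the
four-circuit count `s₄ ≤ C(30, 4) = 27405` the capped cell inequality `cellOK10 8 27 136 27405` holds (twin
`mining/g18/vcells.py`: `1.0349 → 0.9514`), so the `e`-free cores of rank `8` with `35` points satisfy `RLS` at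
level `4`: the frontier cell of the row `p = 8` closes unconditionally.

* `cell_eight_twentyseven_v` — the kernel cell;
* **`c025_core_eight_twentyseven`** — the core of rank `8` with `35` points.
Axioms: standard.
-/

open scoped Matroid

namespace PercRepro

namespace S1

open Set

variable {α : Type}

/-- The cell `(8, 27)` with `s₃ ≤ 136 = ⌊35²/9⌋` (LEMMA V at `n = 35`) and `s₄ ≤ C(30, 4) = 27405`. -/
theorem cell_eight_twentyseven_v : cellOK10 8 27 136 27405 = true := by decide +kernel

/-- **THE CELL `(8, 27)`**: an `e`-free core of rank `8` with `35` points satisfies `RLS` at level `4`. -/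
theorem c025_core_eight_twentyseven (M : Matroid α) [M.Finite] (hR : M.eRank = (8 : ℕ)) (hn : M.E.ncard = 35)
    (hfree : ∀ e ∈ M.E, ∃ A ⊆ M.E \ {e}, e ∉ M.closure A ∧ e ∉ M.closure ((M.E \ {e}) \ A)) :
    ThmN.RLS M 8 4 := by
  have hd : M.E.encard = M.eRank + ((27 : ℕ) : ℕ∞) := by
    rw [hR, ← M.ground_finite.cast_ncard_eq, hn]
    push_cast
    ring
  have hP : {C : Set α | M.IsCircuit C ∧ C.ncard = 3}.ncard ≤ 136 := by
    have h := core_ncard_triangles_le_sq_div_nine M hfree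
    rw [hn] at h
    exact h.trans (by norm_num)
  have hS : {C : Set α | M.IsCircuit C ∧ C.ncard = 4}.ncard ≤ 27405 :=
    (ncard_fourCircuits_le_choose M hd).trans (by decide +kernel)
  exact rls_of_cellOK10 M 8 27 136 27405 (by norm_num) hR hn hfree hP hS (by norm_num) cell_eight_twentyseven_v

end S1

end PercRepro
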